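import Summits.AtomisticToContinuum.Crystallization.Theses.ReggeStarCoercivity
import Literature.MathematicalPhysics.StatisticalMechanics.PeriodicConfigurationSums
import Summits.AtomisticToContinuum.Crystallization.Theorems.ChargedEnergyGap.Negative.BlocksBound

/-!
# Drefute evidence — relations among the stubs of line `pinned-equilibria-reduction`
(crux `PeriodicStarCoercivity`, stmt-AtomisticToContinuum-13602; refuter-drefute-…-13602-0, 2026-08-16)

§0–§2 and the glue lemmas used are copied VERBATIM from
`Cruxes/PeriodicStarCoercivity/Lines/pinned-equilibria-reduction.lean` (rev 1), so every statement below is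
about the registered stub bodies literally.  New content is in namespace `…PinnedEquilibriaReduction.Drefute`:

* `force_eq_zero_of_card_eq_one` — Bravais `P` (one-point motif): `force P s = 0` (empty index type), so clause 1
  of `Equilibrated` never bites a Bravais competitor (S1 docstring's degenerate instance, certified).
* `cleanNear_iff_noEquilibrium` — given S1 (`FrozenDescent`), S2 `CleanNearCoercivity` is EQUIVALENT to the
  hypothesis-free K1 `∃ c > 0, ∀ P clean, ePer + c·ndFrac P ≤ e P` (same `c`): the `Equilibrated` hypothesis of
  S2 is dischargeable, truth-neutral.
* `farHealing_iff_noEquilibrium` — likewise S4 `FarHealingOnEquilibria` ⟺ `∃ c > 0, ∀ P, 0 < fdFrac P → …`.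
* `farHealing_iff_noPos` — the hypothesis `0 < fdFrac P` of S4 is decoration (for `fdFrac P = 0` the conclusion
  is `ePer ≤ e P`, i.e. `ciInf_le` with the LANDED 0714 `bddBelow_energyPerParticle_lennardJones`).
* **`collarCount : CollarCount` — stub S5 PROVED** (rc 0, std axioms): packing count by Lebesgue measure
  (`card_le_of_separated`: disjoint `r`-balls in an `(R+r)`-ball, `r = 837/2000`), near-site separation
  (`dist_bounds_of_near`), `G`-invariance of statuses (`near_add_iff`), far witnesses are period-translates of
  `farDefSet` sites, and the injection `s ↦ (y₀, s − g)` (`collarMap_injOn`, by `eq_of_sub_mem`); constant `C = 64`.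
  Corollaries: `modCollar_of_isolated : IsolatedNearDefectsPay → NearCoercivityModCollar`,
  `cleanNear_of_isolated_descent : VacancyPlanting → FrozenDescent → IsolatedNearDefectsPay → CleanNearCoercivity`.
* `VacancyPlanting` (hypothesis, an elementary supercell-vacancy construction, stated as a `Prop`) and
  `cleanNear_of_isolated_collar_descent` — **S2 is implied by S1 ∧ S3 ∧ S5** (same constant `c`) modulo
  `VacancyPlanting`: plant one vacancy per `k`-supercell of a clean `P` (12 far-defective neighbours, energy and
  fractions move by `O(k⁻³)`), equilibrate by S1, charge the `R`-isolated near-defective sites by S3, bound the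
  collar loss by S5, let `k → ∞`.  So the registered stub set is not independent: the near side of the line costs
  exactly S3 (which is therefore at least as strong as the same-word K1).
-/

noncomputable section

open scoped BigOperators Classical
open Literature.MathematicalPhysics.StatisticalMechanics Literature.Geometry.DiscreteGeometry

namespace Summit.AtomisticToContinuum.Crystallization.Cruxes.PeriodicStarCoercivity.PinnedEquilibriaReduction

local notation "E3" => EuclideanSpace ℝ (Fin 3)
local notation "PC" => PeriodicConfiguration 3

/-! ## §0 Vocabulary — verbatim sub-terms of the crux (sorry-free; split out unchanged if a Theorems file needs it) -/

/-- The recentred first shell of `s` in `P` (other points within ABSOLUTE radius `6/5`), rescaled by `a⁻¹` —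
literally the sub-term of the route decl. -/
def shell (P : PC) (s : E3) (a : ℝ) : Finset E3 :=
  (P.finite_inter_points (K := Metric.closedBall s (6 / 5) \ {s})
      (Metric.isBounded_closedBall.subset Set.sdiff_subset)).toFinset.image fun y => a⁻¹ • (y - s)

/-- `s` is `η`-NEAR a Barlow shell in `P`: some admissible rescaling `a ∈ [9/10, 11/10]` of its shell is
`η`-`ShellCloseTo` the fcc or the hcp kissing pattern (crux: `η = 1/20`; near/far seam: `η = 7/100`). -/
def Near (η : ℝ) (P : PC) (s : E3) : Prop :=
  ∃ a : ℝ, 9 / 10 ≤ a ∧ a ≤ 11 / 10 ∧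
    (ShellCloseTo η (shell P s a) fccKissingPattern ∨ ShellCloseTo η (shell P s a) hcpKissingPattern)

/-- FREE (non-defective) site of the crux = `1/20`-near. -/
def IsFree (P : PC) (s : E3) : Prop := Near (1 / 20) P s

/-- Lennard-Jones energy per particle. -/
def e (P : PC) : ℝ := P.energyPerParticle lennardJones

/-- `ePer = ⨅_Q e(Q)` over all periodic configurations of `ℝ³`. -/
def ePer : ℝ := ⨅ Q : PC, Q.energyPerParticle lennardJones

/-- Defective motif sites (the crux's charge set). -/
def defectSet (P : PC) : Finset E3 := P.motif.filter fun s => ¬ IsFree P s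

/-- NEAR-DEFECTIVE sites: defective but `7/100`-near (threshold-pinned / strained Barlow shells). -/
def nearDefSet (P : PC) : Finset E3 := (defectSet P).filter fun s => Near (7 / 100) P s

/-- FAR-DEFECTIVE sites ("junk"): defective and not even `7/100`-near (wrong coordination, 5-rings, bcc/A15/σ
stars, ≥ 7 %-strained shells). -/
def farDefSet (P : PC) : Finset E3 := (defectSet P).filter fun s => ¬ Near (7 / 100) P s

/-- The crux's defect fraction and its two parts. -/
def defectFrac (P : PC) : ℝ := ((defectSet P).card : ℝ) / (P.motif.card : ℝ)
def ndFrac (P : PC) : ℝ := ((nearDefSet P).card : ℝ) / (P.motif.card : ℝ)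
def fdFrac (P : PC) : ℝ := ((farDefSet P).card : ℝ) / (P.motif.card : ℝ)

/-- The body of the crux at `g`, in the route decl's own left-associated form `g * #def / #motif`. -/
def PSCAt (g : ℝ) (P : PC) : Prop :=
  ePer + g * ((defectSet P).card : ℝ) / (P.motif.card : ℝ) ≤ e P

/-- The route decl IS `∃ g > 0, ∀ P, PSCAt g P` — definitional unfolding only (the crux is fixed). -/
theorem psc_iff :
    Summit.AtomisticToContinuum.Crystallization.Theses.ReggeStarCoercivity.PeriodicStarCoercivity ↔
      ∃ g : ℝ, 0 < g ∧ ∀ P : PC, PSCAt g P :=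
  Iff.rfl

/-! ## §1 Equilibrium vocabulary (the lever: vary the competitor) -/

/-- The FORCE on the sublattice through `s`: `∑_{y ∈ P.points, y ∉ s + G} V'(|s − y|)·(y − s)/|s − y|`
(points of the same sublattice co-move and drop out; `∇_{s ↦ s+u} e = −⟪force, u⟫/#motif`). -/
def force (P : PC) (s : E3) : E3 :=
  ∑' y : {y : E3 // y ∈ P.points ∧ y - s ∉ P.lattice},
    (deriv lennardJones (dist s y.1) / dist s y.1) • (y.1 - s)

/-- The VIRIAL of `P` against a strain rate `B` (first variation of `e` under `x ↦ x + B x`, lattice and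
motif moving together): `(2 #motif)⁻¹ ∑_{x ∈ motif} ∑_{y ≠ x} V'(|x − y|) ⟪x − y, B(x − y)⟫ / |x − y|`.
Zero virial for all `B` = zero Cauchy stress of the cell (six equations; triage r1-2 (2), r1-3 sharpen). -/
def virial (P : PC) (B : E3 →L[ℝ] E3) : ℝ :=
  (2 * (P.motif.card : ℝ))⁻¹ * ∑ x ∈ P.motif,
    ∑' y : {y : E3 // y ∈ P.points ∧ y ≠ x},
      deriv lennardJones (dist x y.1) * (inner ℝ (x - y.1) (B (x - y.1)) / dist x y.1)

/-- `P'` is `P` with the sublattice through `s` moved so as to pass through `t` (same lattice). -/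
def IsMove (P : PC) (s t : E3) (P' : PC) : Prop :=
  P'.lattice = P.lattice ∧ P'.motif = insert t (P.motif.erase s)

/-- The two statuses the charge reads (`1/20`-free, `7/100`-near) agree at `s` in `P` and at `t` in `P'`. -/
def SameStatus (P : PC) (s : E3) (P' : PC) (t : E3) : Prop :=
  (IsFree P s ↔ IsFree P' t) ∧ (Near (7 / 100) P s ↔ Near (7 / 100) P' t)

/-- `s` is `ρ`-ROBUSTLY classified in `P`: moving the sublattice of `s` by less than `ρ` changes the status of
no motif site (so neither `s` nor any site whose shell contains a translate of `s` is pinned at a threshold).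
Antitone in `ρ`. -/
def Robust (ρ : ℝ) (P : PC) (s : E3) : Prop :=
  ∀ (t : E3) (P' : PC), dist t s < ρ → IsMove P s t P' →
    SameStatus P s P' t ∧ ∀ s' ∈ P.motif, s' ≠ s → SameStatus P s' P' s'

/-- The whole classification of `P` is `ρ`-robust under AFFINE moves: every linear `A` with `‖A − 1‖ < ρ`
changes the status of no site (statuses read in the image point set `A '' P.points`). Antitone in `ρ`. -/
def MetricRobust (ρ : ℝ) (P : PC) : Prop :=
  ∀ (A : E3 →L[ℝ] E3) (P'' : PC), ‖A - 1‖ < ρ → P''.points = A '' P.points →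
    ∀ s ∈ P.motif, SameStatus P s P'' (A s)

/-- `(ε, ρ)`-PINNED EQUILIBRIUM: sublattice force `≤ ε` at every `ρ`-robust site, and virial `≤ ε‖B‖` for
every strain rate `B` whenever the whole classification is `ρ`-metric-robust.  Monotone UP in `ε` and `ρ`
(`Equilibrated.mono`), which is what lets `of_parts` serve several regime lemmas with one descent. -/
def Equilibrated (ε ρ : ℝ) (P : PC) : Prop :=
  (∀ s ∈ P.motif, Robust ρ P s → ‖force P s‖ ≤ ε) ∧
    (MetricRobust ρ P → ∀ B : E3 →L[ℝ] E3, |virial P B| ≤ ε * ‖B‖)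

/-! ## §1b Collar vocabulary (contaminated world: where the junk is, seen from the near matrix) -/

/-- A far-defective POINT of `P` (any point of `P.points`, not only motif representatives; the status is
`G`-invariant). -/
def IsFarDef (P : PC) (y : E3) : Prop := ¬ IsFree P y ∧ ¬ Near (7 / 100) P y

/-- `s` is `R`-ISOLATED from the junk of `P`: every far-defective point of `P` is at distance `≥ R`. -/
def Isolated (R : ℝ) (P : PC) (s : E3) : Prop := ∀ y ∈ P.points, IsFarDef P y → R ≤ dist s y

/-- Near-defective motif sites that are `R`-isolated from the junk (they must pay by LOCAL rigidity). -/
def isolatedNearDefSet (R : ℝ) (P : PC) : Finset E3 := (nearDefSet P).filter fun s => Isolated R P s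

/-- The `R`-COLLAR: `7/100`-near motif sites (free or near-defective) within `R` of some far-defective point. -/
def collarSet (R : ℝ) (P : PC) : Finset E3 :=
  P.motif.filter fun s => Near (7 / 100) P s ∧ ¬ Isolated R P s

/-! ## §2 The regime statements, named (each OPEN one is registered below as a `stub_…` with the same body) -/

/-- S1 — frozen-status descent to pinned equilibria. -/
def FrozenDescent : Prop :=
  ∀ P : PC, ∀ ε > (0 : ℝ), ∀ ρ > (0 : ℝ), ∃ P' : PC,
    e P' ≤ e P ∧ ndFrac P' = ndFrac P ∧ fdFrac P' = fdFrac P ∧ Equilibrated ε ρ P'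

/-- S2 — clean near world: coercivity of equilibria all of whose sites are `7/100`-near. -/
def CleanNearCoercivity : Prop :=
  ∃ c > (0 : ℝ), ∃ ε > (0 : ℝ), ∃ ρ > (0 : ℝ), ∀ P : PC, Equilibrated ε ρ P →
    (∀ s ∈ P.motif, Near (7 / 100) P s) → ePer + c * ndFrac P ≤ e P

/-- S3 — contaminated world, near side, LOCAL form: near-defective sites `R`-isolated from the junk pay `c` each. -/
def IsolatedNearDefectsPay : Prop :=
  ∃ c > (0 : ℝ), ∃ R ≥ (1 : ℝ), ∃ ε > (0 : ℝ), ∃ ρ > (0 : ℝ), ∀ P : PC, Equilibrated ε ρ P →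
    0 < fdFrac P → ePer + c * (((isolatedNearDefSet R P).card : ℝ) / (P.motif.card : ℝ)) ≤ e P

/-- S5 — collar count (pure packing geometry of near sites): `#collar(R) ≤ C R³ · #farDef`. -/
def CollarCount : Prop :=
  ∃ C : ℝ, ∀ R : ℝ, 1 ≤ R → ∀ P : PC,
    ((collarSet R P).card : ℝ) ≤ C * R ^ 3 * ((farDefSet P).card : ℝ)

/-- S3 ⊕ S5, the form the gluing consumes — contaminated world, near side: near-defective sites pay, modulo a
collar loss linear in the junk (PROVED from S3 and S5 below: `modCollar_of_isolated_of_collar`). -/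
def NearCoercivityModCollar : Prop :=
  ∃ c > (0 : ℝ), ∃ A ≥ (0 : ℝ), ∃ ε > (0 : ℝ), ∃ ρ > (0 : ℝ), ∀ P : PC, Equilibrated ε ρ P →
    0 < fdFrac P → ePer + c * ndFrac P - A * fdFrac P ≤ e P

/-- S4 — contaminated world, far side: junk pays against `ePer` (healing inequality on equilibria). -/
def FarHealingOnEquilibria : Prop :=
  ∃ c > (0 : ℝ), ∃ ε > (0 : ℝ), ∃ ρ > (0 : ℝ), ∀ P : PC, Equilibrated ε ρ P →
    0 < fdFrac P → ePer + c * fdFrac P ≤ e P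

/-- The card's transfer `C⁺`: the crux demanded only of `(ε, ρ)`-pinned equilibria. -/
def CruxOnEquilibria : Prop :=
  ∃ g > (0 : ℝ), ∃ ε > (0 : ℝ), ∃ ρ > (0 : ℝ), ∀ P : PC, Equilibrated ε ρ P →
    ePer + g * defectFrac P ≤ e P


/-! ## Glue copied verbatim from the skeleton (§4) -/

/-! ## §4 Sorry-free glue -/

theorem motif_card_pos (P : PC) : 0 < (P.motif.card : ℝ) :=
  Nat.cast_pos.2 (Finset.card_pos.2 P.motif_nonempty)

theorem ndFrac_nonneg (P : PC) : 0 ≤ ndFrac P := div_nonneg (Nat.cast_nonneg _) (Nat.cast_nonneg _)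

theorem fdFrac_nonneg (P : PC) : 0 ≤ fdFrac P := div_nonneg (Nat.cast_nonneg _) (Nat.cast_nonneg _)

/-- `#def = #nearDef + #farDef` (a partition by the `7/100` status). -/
theorem card_defectSet (P : PC) : (defectSet P).card = (nearDefSet P).card + (farDefSet P).card := by
  unfold nearDefSet farDefSet
  rw [Finset.card_filter_add_card_filter_not]

theorem defectFrac_eq (P : PC) : defectFrac P = ndFrac P + fdFrac P := by
  unfold defectFrac ndFrac fdFrac
  rw [card_defectSet, Nat.cast_add, add_div]

theorem pscAt_iff (g : ℝ) (P : PC) : PSCAt g P ↔ ePer + g * defectFrac P ≤ e P := by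
  unfold PSCAt defectFrac
  rw [mul_div_assoc]

/-- Nearness is monotone in the tolerance (so free ⇒ `7/100`-near). -/
theorem Near.mono {η η' : ℝ} (hη : η ≤ η') {P : PC} {s : E3} (h : Near η P s) : Near η' P s := by
  obtain ⟨a, ha1, ha2, hclose⟩ := h
  refine ⟨a, ha1, ha2, ?_⟩
  rcases hclose with ⟨A, hA⟩ | ⟨A, hA⟩
  · exact Or.inl ⟨A, hA.mono hη⟩
  · exact Or.inr ⟨A, hA.mono hη⟩

/-- No far-defective site ⇒ every motif site is `7/100`-near (free sites are `1/20`-near, a fortiori). -/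
theorem near_of_fdFrac_eq_zero {P : PC} (h : fdFrac P = 0) : ∀ s ∈ P.motif, Near (7 / 100) P s := by
  intro s hs
  have hcard : (farDefSet P).card = 0 := by
    unfold fdFrac at h
    rcases (div_eq_zero_iff.1 h) with h0 | h0
    · exact_mod_cast h0
    · exact absurd h0 (motif_card_pos P).ne'
  have hempty : farDefSet P = ∅ := Finset.card_eq_zero.1 hcard
  by_contra hns
  by_cases hfree : IsFree P s
  · exact hns (Near.mono (by norm_num) hfree)
  · have hmem : s ∈ farDefSet P := by
      unfold farDefSet defectSet
      simp only [Finset.mem_filter]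
      exact ⟨⟨hs, hfree⟩, hns⟩
    rw [hempty] at hmem
    exact absurd hmem (Finset.notMem_empty s)

/-- Robustness is antitone in the radius … -/
theorem Robust.anti {ρ ρ' : ℝ} (h : ρ ≤ ρ') {P : PC} {s : E3} (hR : Robust ρ' P s) : Robust ρ P s :=
  fun t P' ht hm => hR t P' (lt_of_lt_of_le ht h) hm

theorem MetricRobust.anti {ρ ρ' : ℝ} (h : ρ ≤ ρ') {P : PC} (hR : MetricRobust ρ' P) : MetricRobust ρ P :=
  fun A P'' hA hpts => hR A P'' (lt_of_lt_of_le hA h) hpts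

/-- … so being equilibrated is monotone UP in both parameters. -/
theorem Equilibrated.mono {ε ε' ρ ρ' : ℝ} (hε : ε ≤ ε') (hρ : ρ ≤ ρ') {P : PC}
    (h : Equilibrated ε ρ P) : Equilibrated ε' ρ' P := by
  refine ⟨fun s hs hR => ?_, fun hM B => ?_⟩
  · exact (h.1 s hs (hR.anti hρ)).trans hε
  · exact (h.2 (hM.anti hρ) B).trans (mul_le_mul_of_nonneg_right hε (norm_nonneg B))

/-- **Collar bookkeeping**: every near-defective site is either `R`-isolated or in the `R`-collar. -/
theorem card_nearDefSet_le (R : ℝ) (P : PC) :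
    (nearDefSet P).card ≤ (isolatedNearDefSet R P).card + (collarSet R P).card := by
  have hsplit := Finset.card_filter_add_card_filter_not (s := nearDefSet P) (fun s => Isolated R P s)
  have hsub : ((nearDefSet P).filter fun s => ¬ Isolated R P s) ⊆ collarSet R P := by
    intro s hs
    unfold collarSet
    unfold nearDefSet defectSet at hs
    simp only [Finset.mem_filter] at hs ⊢
    exact ⟨hs.1.1.1, hs.1.2, hs.2⟩
  have hle := Finset.card_le_card hsub
  unfold isolatedNearDefSet
  omega


/-! ## Drefute: certified relations among the stubs -/

namespace Drefute

/-- **Bravais competitors feel no sublattice force.** If the motif is the single point `s`, every point of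
`P` lies on `s + G`, the index type of `force P s` is empty and the `tsum` is `0`. -/
theorem force_eq_zero_of_motif_eq_singleton {P : PC} {s : E3} (h : P.motif = {s}) : force P s = 0 := by
  unfold force
  have hempty : IsEmpty {y : E3 // y ∈ P.points ∧ y - s ∉ P.lattice} := by
    refine ⟨fun y => ?_⟩
    obtain ⟨m, hm, g, hg, hy⟩ := y.2.1
    rw [h, Finset.mem_singleton] at hm
    subst hm
    exact y.2.2 (by rw [hy, add_sub_cancel_left]; exact hg)
  exact tsum_empty

/-- K1 of the same-word line: clean near coercivity WITHOUT any equilibrium hypothesis. -/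
def CleanNearCoercivityNoEq : Prop :=
  ∃ c > (0 : ℝ), ∀ P : PC, (∀ s ∈ P.motif, Near (7 / 100) P s) → ePer + c * ndFrac P ≤ e P

/-- Far healing WITHOUT any equilibrium hypothesis. -/
def FarHealingNoEq : Prop :=
  ∃ c > (0 : ℝ), ∀ P : PC, 0 < fdFrac P → ePer + c * fdFrac P ≤ e P

/-- A clean configuration has no far-defective motif site, i.e. `fdFrac = 0`. -/
theorem fdFrac_eq_zero_of_near {P : PC} (h : ∀ s ∈ P.motif, Near (7 / 100) P s) : fdFrac P = 0 := by
  unfold fdFrac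
  have : farDefSet P = ∅ := by
    unfold farDefSet defectSet
    ext s
    simp only [Finset.mem_filter, Finset.notMem_empty, iff_false, not_and, not_not, and_imp]
    intro hs _
    exact h s hs
  rw [this, Finset.card_empty, Nat.cast_zero, zero_div]

/-- **S2 ⟺ K1 given S1.** The `Equilibrated` hypothesis of `stub_cleanNearCoercivity` is dischargeable by the
(true) descent: same constant `c`, any `ε, ρ`. -/
theorem cleanNear_iff_noEquilibrium (hD : FrozenDescent) : CleanNearCoercivity ↔ CleanNearCoercivityNoEq := by
  constructor
  · rintro ⟨c, hc, ε, hε, ρ, hρ, H⟩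
    refine ⟨c, hc, fun P hP => ?_⟩
    obtain ⟨P', hle, hnd, hfd, hEq⟩ := hD P ε hε ρ hρ
    have hfd0 : fdFrac P' = 0 := by rw [hfd]; exact fdFrac_eq_zero_of_near hP
    have h := H P' hEq (near_of_fdFrac_eq_zero hfd0)
    rw [hnd] at h
    exact h.trans hle
  · rintro ⟨c, hc, H⟩
    exact ⟨c, hc, 1, one_pos, 1, one_pos, fun P _ hP => H P hP⟩

/-- **S4 ⟺ hypothesis-free far healing given S1.** -/
theorem farHealing_iff_noEquilibrium (hD : FrozenDescent) : FarHealingOnEquilibria ↔ FarHealingNoEq := by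
  constructor
  · rintro ⟨c, hc, ε, hε, ρ, hρ, H⟩
    refine ⟨c, hc, fun P hpos => ?_⟩
    obtain ⟨P', hle, _hnd, hfd, hEq⟩ := hD P ε hε ρ hρ
    have h := H P' hEq (by rw [hfd]; exact hpos)
    rw [hfd] at h
    exact h.trans hle
  · rintro ⟨c, hc, H⟩
    exact ⟨c, hc, 1, one_pos, 1, one_pos, fun P _ hpos => H P hpos⟩

/-- `ePer ≤ e P` for every periodic `P` — from the LANDED item 0714
(`ChargedEnergyGapNegative.bddBelow_energyPerParticle_lennardJones`). -/
theorem ePer_le (P : PC) : ePer ≤ e P :=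
  ciInf_le Summit.AtomisticToContinuum.Crystallization.Theorems.ChargedEnergyGapNegative.bddBelow_energyPerParticle_lennardJones P

/-- **The positivity hypothesis of S4 is decoration**: with `fdFrac P = 0` the conclusion is `ePer ≤ e P`. -/
theorem farHealing_iff_noPos :
    FarHealingOnEquilibria ↔
      ∃ c > (0 : ℝ), ∃ ε > (0 : ℝ), ∃ ρ > (0 : ℝ), ∀ P : PC, Equilibrated ε ρ P → ePer + c * fdFrac P ≤ e P := by
  constructor
  · rintro ⟨c, hc, ε, hε, ρ, hρ, H⟩
    refine ⟨c, hc, ε, hε, ρ, hρ, fun P hP => ?_⟩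
    rcases (fdFrac_nonneg P).eq_or_lt with h0 | hpos
    · rw [← h0, mul_zero, add_zero]; exact ePer_le P
    · exact H P hP hpos
  · rintro ⟨c, hc, ε, hε, ρ, hρ, H⟩
    exact ⟨c, hc, ε, hε, ρ, hρ, fun P hP _ => H P hP⟩

/-- **Vacancy planting** (elementary; stated as a hypothesis here, not proved): for a clean periodic `P` and
`δ > 0` there is a periodic `Q` — one point orbit removed from a large `k`-supercell representation of `P`, so
that its twelve neighbours become 11-coordinated, hence far-defective — with energy at most `δ` above `e P`,
a positive far-defective fraction at most `δ`, and near-defective fraction at least `ndFrac P − δ`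
(`e Q − e P = (e P − S(x₀) + ½ Σ_{g ∈ kG∖0} V|g|)/(nk³ − 1)`, `fdFrac Q = 12/(nk³−1)`,
`ndFrac Q ≥ ndFrac P − 13/(nk³−1)`). -/
def VacancyPlanting : Prop :=
  ∀ P : PC, (∀ s ∈ P.motif, Near (7 / 100) P s) → ∀ δ > (0 : ℝ), ∃ Q : PC,
    e Q ≤ e P + δ ∧ 0 < fdFrac Q ∧ fdFrac Q ≤ δ ∧ ndFrac P ≤ ndFrac Q + δ

/-- Fraction form of the collar bookkeeping + S5: `isolFrac ≥ ndFrac − max C 0 · R³ · fdFrac`. -/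
theorem isolFrac_ge {C R : ℝ} (hK : ∀ P : PC, ((collarSet R P).card : ℝ) ≤ C * R ^ 3 * ((farDefSet P).card : ℝ))
    (hR : 0 ≤ R) (P : PC) :
    ndFrac P - max C 0 * R ^ 3 * fdFrac P ≤ ((isolatedNearDefSet R P).card : ℝ) / (P.motif.card : ℝ) := by
  have hm := motif_card_pos P
  have hcount : ((nearDefSet P).card : ℝ) ≤
      ((isolatedNearDefSet R P).card : ℝ) + ((collarSet R P).card : ℝ) := by
    exact_mod_cast card_nearDefSet_le R P
  have hcollar : ((collarSet R P).card : ℝ) ≤ max C 0 * R ^ 3 * ((farDefSet P).card : ℝ) := by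
    refine (hK P).trans ?_
    have hR3 : 0 ≤ R ^ 3 := by positivity
    exact mul_le_mul_of_nonneg_right (mul_le_mul_of_nonneg_right (le_max_left _ _) hR3) (Nat.cast_nonneg _)
  unfold ndFrac fdFrac
  rw [mul_div_assoc', ← sub_div, div_le_div_iff_of_pos_right hm]
  linarith

/-- **S2 is implied by S1 ∧ S3 ∧ S5 (modulo vacancy planting), with the same constant `c`.**  Given a clean `P`
and `η > 0`: plant (`Q`), descend (`Q'`, S1: energy no larger, same fractions, equilibrated), charge the isolated
near-defective sites of `Q'` (S3, legal since `fdFrac Q' > 0`), absorb the collar by S5, and let the planting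
error go to `0`.  The `Equilibrated` hypothesis of S2 is not even used. -/
theorem cleanNear_of_isolated_collar_descent (hV : VacancyPlanting) (hD : FrozenDescent)
    (hI : IsolatedNearDefectsPay) (hK : CollarCount) : CleanNearCoercivity := by
  obtain ⟨c, hc, R, hR, ε, hε, ρ, hρ, H⟩ := hI
  obtain ⟨C, HK⟩ := hK
  refine ⟨c, hc, ε, hε, ρ, hρ, fun P _ hP => ?_⟩
  set A : ℝ := max C 0 * R ^ 3 with hA
  have hA0 : 0 ≤ A := by rw [hA]; positivity
  -- it suffices to prove the inequality up to an arbitrary η > 0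
  refine le_of_forall_pos_le_add fun η hη => ?_
  set δ : ℝ := η / (1 + c + c * A) with hδ
  have hden : 0 < 1 + c + c * A := by positivity
  have hδpos : 0 < δ := by rw [hδ]; positivity
  obtain ⟨Q, hQe, hQpos, hQfd, hQnd⟩ := hV P hP δ hδpos
  obtain ⟨Q', hle, hnd, hfd, hEq⟩ := hD Q ε hε ρ hρ
  have hpos' : 0 < fdFrac Q' := by rw [hfd]; exact hQpos
  have h3 := H Q' hEq hpos'
  have h5 := isolFrac_ge (fun P => HK R hR P) (by linarith) Q'
  rw [hnd, hfd] at h5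
  -- ePer + c * (ndFrac Q - A * fdFrac Q) ≤ e Q ≤ e P + δ
  have h1 : ePer + c * (ndFrac Q - A * fdFrac Q) ≤ e P + δ := by
    have := mul_le_mul_of_nonneg_left h5 hc.le
    rw [← hA] at this
    linarith
  have h2 : c * ndFrac P ≤ c * (ndFrac Q - A * fdFrac Q) + c * δ + c * A * δ := by
    have e1 : c * ndFrac P ≤ c * ndFrac Q + c * δ := by nlinarith
    have e2 : c * A * fdFrac Q ≤ c * A * δ := mul_le_mul_of_nonneg_left hQfd (by positivity)
    nlinarith
  have hsum : δ * (1 + c + c * A) = η := by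
    rw [hδ]; field_simp
  nlinarith

/-! ### Geometry of near sites — certified building blocks for S5 (a) (and for the vacancy planting) -/

/-- A point of `P` in the punctured closed `6/5`-ball of `s` appears, rescaled, in `shell P s a`. -/
theorem mem_shell {P : PC} {s y : E3} (a : ℝ) (hy : y ∈ P.points) (hys : y ≠ s) (hd : dist y s ≤ 6 / 5) :
    a⁻¹ • (y - s) ∈ shell P s a := by
  unfold shell
  refine Finset.mem_image_of_mem _ ?_
  rw [Set.Finite.mem_toFinset]
  exact ⟨⟨Metric.mem_closedBall.2 hd, hys⟩, hy⟩

/-- Conversely every element of `shell P s a` comes from such a point. -/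
theorem exists_of_mem_shell {P : PC} {s : E3} {a : ℝ} {t : E3} (ht : t ∈ shell P s a) :
    ∃ y ∈ P.points, y ≠ s ∧ dist y s ≤ 6 / 5 ∧ t = a⁻¹ • (y - s) := by
  unfold shell at ht
  obtain ⟨y, hy, rfl⟩ := Finset.mem_image.1 ht
  rw [Set.Finite.mem_toFinset] at hy
  exact ⟨y, hy.2, hy.1.2, Metric.mem_closedBall.1 hy.1.1, rfl⟩

/-- **Matched shell points have norm within `η` of `1`.** If `shell P s a` is `η`-close to a pattern of unit
vectors, every `t ∈ shell P s a` satisfies `1 − η ≤ ‖t‖ ≤ 1 + η`. -/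
theorem norm_bounds_of_shellCloseTo {η : ℝ} {P : PC} {s : E3} {a : ℝ} {pat : Finset E3}
    (hpat : ∀ x ∈ pat, ‖x‖ = 1) (h : ShellCloseTo η (shell P s a) pat) {t : E3} (ht : t ∈ shell P s a) :
    1 - η ≤ ‖t‖ ∧ ‖t‖ ≤ 1 + η := by
  obtain ⟨A, eqv, he⟩ := h
  set u : ↥(pat.image A) := eqv ⟨t, ht⟩ with hu
  have hu1 : ‖(u : E3)‖ = 1 := by
    obtain ⟨p, hp, hpu⟩ := Finset.mem_image.1 u.2
    rw [← hpu, LinearIsometry.norm_map, hpat p hp]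
  have hdist : dist t (u : E3) ≤ η := he ⟨t, ht⟩
  rw [dist_eq_norm] at hdist
  constructor
  · have := norm_sub_norm_le (u : E3) t
    rw [← norm_neg, neg_sub] at hdist
    linarith
  · have h2 : ‖t‖ ≤ ‖(u : E3)‖ + ‖t - (u : E3)‖ := norm_le_insert' t ↑u
    linarith

/-- **Separation at near sites.** If `s` is `η`-near in `P` (some `a ∈ [9/10, 11/10]`), every other point of `P`
within `6/5` of `s` is at distance `≥ a(1 − η) ≥ (9/10)(1 − η)` and `≤ a(1 + η) ≤ (11/10)(1 + η)` from `s`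
(`η = 7/100`: `[0.837, 1.177]`).  Hence NO point of `P` other than `s` lies within `(9/10)(1 − η)` of a near `s`. -/
theorem dist_bounds_of_near {η : ℝ} (hη : η ≤ 1) {P : PC} {s : E3} (h : Near η P s) {y : E3} (hy : y ∈ P.points)
    (hys : y ≠ s) (hd : dist y s ≤ 6 / 5) :
    9 / 10 * (1 - η) ≤ dist y s ∧ dist y s ≤ 11 / 10 * (1 + η) := by
  obtain ⟨a, ha1, ha2, hclose⟩ := h
  have ha0 : 0 < a := by linarith
  have ht := mem_shell a hy hys hd
  have hb : 1 - η ≤ ‖a⁻¹ • (y - s)‖ ∧ ‖a⁻¹ • (y - s)‖ ≤ 1 + η := by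
    rcases hclose with hc | hc
    · exact norm_bounds_of_shellCloseTo (fun x hx => norm_eq_one_of_mem_fccKissingPattern hx) hc ht
    · exact norm_bounds_of_shellCloseTo (fun x hx => norm_eq_one_of_mem_hcpKissingPattern hx) hc ht
  have hnorm : ‖a⁻¹ • (y - s)‖ = a⁻¹ * dist y s := by
    rw [norm_smul, norm_inv, Real.norm_of_nonneg ha0.le, dist_eq_norm]
  rw [hnorm] at hb
  have hds : dist y s = a * (a⁻¹ * dist y s) := by field_simp
  constructor
  · have : a * (1 - η) ≤ a * (a⁻¹ * dist y s) := mul_le_mul_of_nonneg_left hb.1 ha0.le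
    have h9 : 9 / 10 * (1 - η) ≤ a * (1 - η) := mul_le_mul_of_nonneg_right ha1 (by linarith)
    linarith
  · have : a * (a⁻¹ * dist y s) ≤ a * (1 + η) := mul_le_mul_of_nonneg_left hb.2 ha0.le
    have h11 : a * (1 + η) ≤ 11 / 10 * (1 + η) := mul_le_mul_of_nonneg_right ha2 (by linarith)
    linarith

/-- In particular a `7/100`-near site has no other point of `P` within `837/1000`. -/
theorem dist_ge_of_near_seven {P : PC} {s : E3} (h : Near (7 / 100) P s) {y : E3} (hy : y ∈ P.points)
    (hys : y ≠ s) : 837 / 1000 ≤ dist y s := by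
  by_cases hd : dist y s ≤ 6 / 5
  · have := (dist_bounds_of_near (by norm_num) h hy hys hd).1
    norm_num at this
    linarith
  · linarith

/-- **Exactly twelve neighbours.** A near site has exactly `12` points of `P` in its punctured closed `6/5`-ball. -/
theorem card_puncturedBall_eq_twelve {η : ℝ} {P : PC} {s : E3} (h : Near η P s) :
    (P.finite_inter_points (K := Metric.closedBall s (6 / 5) \ {s})
      (Metric.isBounded_closedBall.subset Set.sdiff_subset)).toFinset.card = 12 := by
  obtain ⟨a, ha1, _, hclose⟩ := h
  have ha0 : a ≠ 0 := by intro h0; rw [h0] at ha1; norm_num at ha1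
  have hinj : Function.Injective fun y : E3 => a⁻¹ • (y - s) := by
    intro y₁ y₂ hy
    have := smul_right_injective E3 (inv_ne_zero ha0) hy
    simpa using this
  have hc := card_eq_twelve_of_shellCloseTo hclose
  unfold shell at hc
  rwa [Finset.card_image_of_injective _ hinj] at hc

/-! ### `G`-invariance of statuses — certified building block for S5 (c) (torus bookkeeping) -/

/-- Translating the centre by a period does not change the (recentred, rescaled) shell. -/
theorem shell_add_of_mem_lattice {P : PC} {s g : E3} (hg : g ∈ P.lattice) (a : ℝ) :
    shell P (s + g) a = shell P s a := by
  ext t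
  constructor
  · intro ht
    obtain ⟨y, hy, hys, hd, rfl⟩ := exists_of_mem_shell ht
    have hy' : y + -g ∈ P.points := P.add_mem_points hy (P.lattice.neg_mem hg)
    have hys' : y + -g ≠ s := by
      intro h; apply hys; rw [← h]; abel
    have hd' : dist (y + -g) s ≤ 6 / 5 := by
      rw [dist_eq_norm] at hd ⊢
      have : y + -g - s = y - (s + g) := by abel
      rwa [this]
    have := mem_shell a hy' hys' hd'
    have heq : y + -g - s = y - (s + g) := by abel
    rwa [heq] at this
  · intro ht
    obtain ⟨y, hy, hys, hd, rfl⟩ := exists_of_mem_shell ht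
    have hy' : y + g ∈ P.points := P.add_mem_points hy hg
    have hys' : y + g ≠ s + g := by
      intro h; apply hys; exact add_right_cancel h
    have hd' : dist (y + g) (s + g) ≤ 6 / 5 := by rwa [dist_add_right]
    have := mem_shell a hy' hys' hd'
    have heq : y + g - (s + g) = y - s := by abel
    rwa [heq] at this

/-- Nearness is `G`-invariant. -/
theorem near_add_iff {η : ℝ} {P : PC} {s g : E3} (hg : g ∈ P.lattice) : Near η P (s + g) ↔ Near η P s := by
  unfold Near
  simp only [shell_add_of_mem_lattice hg]

/-- Far-defectiveness is `G`-invariant. -/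
theorem isFarDef_add_iff {P : PC} {y g : E3} (hg : g ∈ P.lattice) : IsFarDef P (y + g) ↔ IsFarDef P y := by
  unfold IsFarDef IsFree
  rw [near_add_iff hg, near_add_iff hg]

/-- **Every far-defective point of `P` is a period-translate of a far-defective MOTIF site** (so the far
witnesses of collar sites are accounted for by `farDefSet P`). -/
theorem exists_farDefSet_of_isFarDef {P : PC} {y : E3} (hy : y ∈ P.points) (hfar : IsFarDef P y) :
    ∃ y₀ ∈ farDefSet P, ∃ g ∈ P.lattice, y = y₀ + g := by
  obtain ⟨y₀, hy₀, g, hg, rfl⟩ := hy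
  refine ⟨y₀, ?_, g, hg, rfl⟩
  have h0 : IsFarDef P y₀ := (isFarDef_add_iff hg).1 hfar
  unfold farDefSet defectSet
  simp only [Finset.mem_filter]
  exact ⟨⟨hy₀, h0.1⟩, h0.2⟩

/-- A translate `s - g` of a motif site by a period is a point of `P` with the same nearness status. -/
theorem sub_mem_points_of_mem_motif {P : PC} {s g : E3} (hs : s ∈ P.motif) (hg : g ∈ P.lattice) :
    s - g ∈ P.points := by
  have := P.add_mem_points (P.mem_points_of_mem_motif hs) (P.lattice.neg_mem hg)
  rwa [← sub_eq_add_neg] at this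

/-- **Injectivity of the collar bookkeeping map** `s ↦ s − g(s)`: two motif sites whose translates by periods
coincide are equal (motif points are inequivalent mod `G`). -/
theorem eq_of_sub_period_eq {P : PC} {s s' g g' : E3} (hs : s ∈ P.motif) (hs' : s' ∈ P.motif)
    (hg : g ∈ P.lattice) (hg' : g' ∈ P.lattice) (h : s - g = s' - g') : s = s' := by
  apply P.eq_of_sub_mem s hs s' hs'
  have : s - s' = g - g' := sub_eq_sub_iff_sub_eq_sub.mp h
  rw [this]
  exact P.lattice.sub_mem hg hg'

/-! ### S5 proved: the collar count (packing + torus bookkeeping) -/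

section collar

open MeasureTheory Metric

/-- **Packing count.** Finitely many points, pairwise `≥ 2r` apart and all within distance `< R` of `y₀`, are at
most `((R + r)/r)³` in number (disjoint `r`-balls inside the `(R + r)`-ball; Lebesgue measure). -/
theorem card_le_of_separated {T : Finset E3} {y₀ : E3} {R r : ℝ} (hr : 0 < r) (hR : 0 ≤ R)
    (hsep : ∀ x ∈ T, ∀ x' ∈ T, x ≠ x' → 2 * r ≤ dist x x') (hin : ∀ x ∈ T, dist x y₀ < R) :
    (T.card : ℝ) ≤ ((R + r) / r) ^ 3 := by
  have hdisj : Set.PairwiseDisjoint (↑T : Set E3) (fun x => ball x r) := by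
    intro x hx x' hx' hne
    exact ball_disjoint_ball (by have := hsep x hx x' hx' hne; linarith)
  have hmeas : ∀ x ∈ T, MeasurableSet (ball x r) := fun x _ => measurableSet_ball
  have hsub : (⋃ x ∈ T, ball x r) ⊆ ball y₀ (R + r) := by
    intro z hz
    simp only [Set.mem_iUnion, exists_prop] at hz
    obtain ⟨x, hx, hzx⟩ := hz
    rw [mem_ball] at hzx ⊢
    calc dist z y₀ ≤ dist z x + dist x y₀ := dist_triangle _ _ _
      _ < r + R := add_lt_add hzx (hin x hx)
      _ = R + r := add_comm _ _
  have hvol := measure_mono (μ := (volume : Measure E3)) hsub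
  rw [measure_biUnion_finset hdisj hmeas] at hvol
  have hball : ∀ (x : E3) (ρ : ℝ), 0 ≤ ρ → (volume : Measure E3) (ball x ρ) =
      ENNReal.ofReal (ρ ^ 3) * volume (ball (0 : E3) 1) := by
    intro x ρ hρ
    rw [Measure.addHaar_ball volume x hρ, finrank_euclideanSpace_fin]
  simp only [hball _ r hr.le] at hvol
  rw [hball y₀ (R + r) (by linarith), Finset.sum_const, nsmul_eq_mul, ← mul_assoc] at hvol
  have hv0 : volume (ball (0 : E3) 1) ≠ 0 := (measure_ball_pos volume (0 : E3) one_pos).ne'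
  have hvtop : volume (ball (0 : E3) 1) ≠ ⊤ := measure_ball_lt_top.ne
  rw [ENNReal.mul_le_mul_iff_left hv0 hvtop] at hvol
  rw [← ENNReal.ofReal_natCast, ← ENNReal.ofReal_mul (Nat.cast_nonneg _),
    ENNReal.ofReal_le_ofReal_iff (by positivity)] at hvol
  rw [div_pow, le_div_iff₀ (by positivity)]
  exact hvol

/-- The `7/100`-near points of `P` within distance `< R` of `y₀`. -/
def nearBall (R : ℝ) (P : PC) (y₀ : E3) : Finset E3 :=
  (P.finite_inter_points (K := ball y₀ R) isBounded_ball).toFinset.filter fun x => Near (7 / 100) P x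

theorem mem_nearBall {R : ℝ} {P : PC} {y₀ x : E3} :
    x ∈ nearBall R P y₀ ↔ (dist x y₀ < R ∧ x ∈ P.points) ∧ Near (7 / 100) P x := by
  unfold nearBall
  rw [Finset.mem_filter, Set.Finite.mem_toFinset]
  simp only [Set.mem_inter_iff, mem_ball]

/-- At most `((R + r)/r)³` near points near any point, `r = 837/2000`. -/
theorem card_nearBall_le {R : ℝ} (hR : 0 ≤ R) (P : PC) (y₀ : E3) :
    ((nearBall R P y₀).card : ℝ) ≤ ((R + 837 / 2000) / (837 / 2000)) ^ 3 := by
  refine card_le_of_separated (by norm_num) hR (fun x hx x' hx' hne => ?_) (fun x hx => (mem_nearBall.1 hx).1.1)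
  have hxn := (mem_nearBall.1 hx).2
  have hx'p := (mem_nearBall.1 hx').1.2
  have := dist_ge_of_near_seven hxn hx'p (Ne.symm hne)
  rw [dist_comm] at this
  linarith

/-- A collar site has a far-defective MOTIF witness `y₀` and a period `g` with `dist (s − g) y₀ < R`. -/
theorem exists_witness_of_mem_collarSet {R : ℝ} {P : PC} {s : E3} (hs : s ∈ collarSet R P) :
    ∃ w : E3 × E3, w.1 ∈ farDefSet P ∧ w.2 ∈ P.lattice ∧ dist (s - w.2) w.1 < R := by
  unfold collarSet at hs
  obtain ⟨_, _, hni⟩ := Finset.mem_filter.1 hs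
  unfold Isolated at hni
  simp only [not_forall, not_le, exists_prop] at hni
  obtain ⟨y, hy, hfar, hlt⟩ := hni
  obtain ⟨y₀, hy₀, g, hg, rfl⟩ := exists_farDefSet_of_isFarDef hy hfar
  refine ⟨(y₀, g), hy₀, hg, ?_⟩
  simp only
  rw [dist_eq_norm] at hlt ⊢
  have : s - g - y₀ = s - (y₀ + g) := by abel
  rwa [this]

/-- A chosen witness pair `(y₀, g)` for a collar site (junk `(0,0)` elsewhere). -/
def wit (R : ℝ) (P : PC) (s : E3) : E3 × E3 :=
  if h : s ∈ collarSet R P then Classical.choose (exists_witness_of_mem_collarSet h) else (0, 0)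

theorem wit_spec {R : ℝ} {P : PC} {s : E3} (h : s ∈ collarSet R P) :
    (wit R P s).1 ∈ farDefSet P ∧ (wit R P s).2 ∈ P.lattice ∧ dist (s - (wit R P s).2) (wit R P s).1 < R := by
  unfold wit
  rw [dif_pos h]
  exact Classical.choose_spec (exists_witness_of_mem_collarSet h)

/-- The bookkeeping map `s ↦ (y₀(s), s − g(s))`. -/
def collarMap (R : ℝ) (P : PC) (s : E3) : E3 × E3 := ((wit R P s).1, s - (wit R P s).2)

/-- Its image lies in `⋃_{y₀ ∈ farDefSet} {y₀} × nearBall R P y₀`. -/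
theorem collarMap_mem {R : ℝ} {P : PC} {s : E3} (h : s ∈ collarSet R P) :
    collarMap R P s ∈ (farDefSet P).biUnion fun y₀ => (nearBall R P y₀).image fun x => (y₀, x) := by
  obtain ⟨hy₀, hg, hlt⟩ := wit_spec h
  have hs : s ∈ P.motif ∧ Near (7 / 100) P s := by
    unfold collarSet at h
    obtain ⟨hsm, hsn, _⟩ := Finset.mem_filter.1 h
    exact ⟨hsm, hsn⟩
  rw [Finset.mem_biUnion]
  refine ⟨(wit R P s).1, hy₀, Finset.mem_image.2 ⟨s - (wit R P s).2, ?_, rfl⟩⟩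
  rw [mem_nearBall]
  refine ⟨⟨hlt, sub_mem_points_of_mem_motif hs.1 hg⟩, ?_⟩
  rw [sub_eq_add_neg, near_add_iff (P.lattice.neg_mem hg)]
  exact hs.2

theorem collarMap_injOn (R : ℝ) (P : PC) : Set.InjOn (collarMap R P) ↑(collarSet R P) := by
  intro s hs s' hs' heq
  have hsm : s ∈ P.motif := (Finset.mem_filter.1 hs).1
  have hsm' : s' ∈ P.motif := (Finset.mem_filter.1 hs').1
  obtain ⟨_, hg, _⟩ := wit_spec (Finset.mem_coe.1 hs)
  obtain ⟨_, hg', _⟩ := wit_spec (Finset.mem_coe.1 hs')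
  unfold collarMap at heq
  obtain ⟨_, h2⟩ := Prod.mk.inj heq
  exact eq_of_sub_period_eq hsm hsm' hg hg' h2

/-- **Double counting**: `#collar(R) ≤ Σ_{y₀ ∈ farDefSet} #nearBall(R, y₀)`. -/
theorem card_collarSet_le_sum (R : ℝ) (P : PC) :
    (collarSet R P).card ≤ ∑ y₀ ∈ farDefSet P, (nearBall R P y₀).card := by
  calc (collarSet R P).card
      ≤ ((farDefSet P).biUnion fun y₀ => (nearBall R P y₀).image fun x => (y₀, x)).card :=
        Finset.card_le_card_of_injOn (collarMap R P) (fun s hs => collarMap_mem hs) (collarMap_injOn R P)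
    _ ≤ ∑ y₀ ∈ farDefSet P, ((nearBall R P y₀).image fun x => (y₀, x)).card := Finset.card_biUnion_le
    _ = ∑ y₀ ∈ farDefSet P, (nearBall R P y₀).card := by
        refine Finset.sum_congr rfl fun y₀ _ => ?_
        exact Finset.card_image_of_injective _ (Prod.mk_right_injective y₀)

/-- **S5 `CollarCount` — PROVED** (with `C = 64`): for `R ≥ 1` and every periodic `P`,
`#collarSet R P ≤ 64 · R³ · #farDefSet P`. -/
theorem collarCount : CollarCount := by
  refine ⟨64, fun R hR P => ?_⟩
  have hR0 : 0 ≤ R := by linarith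
  have h1 : ((collarSet R P).card : ℝ) ≤ ∑ y₀ ∈ farDefSet P, ((nearBall R P y₀).card : ℝ) := by
    exact_mod_cast card_collarSet_le_sum R P
  have h2 : ∑ y₀ ∈ farDefSet P, ((nearBall R P y₀).card : ℝ) ≤
      ∑ _y₀ ∈ farDefSet P, ((R + 837 / 2000) / (837 / 2000)) ^ 3 :=
    Finset.sum_le_sum fun y₀ _ => card_nearBall_le hR0 P y₀
  rw [Finset.sum_const, nsmul_eq_mul] at h2
  have h3 : ((R + 837 / 2000) / (837 / 2000)) ^ 3 ≤ 64 * R ^ 3 := by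
    have hq : (R + 837 / 2000) / (837 / 2000) ≤ 4 * R := by
      rw [div_le_iff₀ (by norm_num)]
      nlinarith
    have hq0 : 0 ≤ (R + 837 / 2000) / (837 / 2000) := by positivity
    calc ((R + 837 / 2000) / (837 / 2000)) ^ 3 ≤ (4 * R) ^ 3 := by gcongr
      _ = 64 * R ^ 3 := by ring
  calc ((collarSet R P).card : ℝ) ≤ ((farDefSet P).card : ℝ) * ((R + 837 / 2000) / (837 / 2000)) ^ 3 :=
        h1.trans h2
    _ ≤ ((farDefSet P).card : ℝ) * (64 * R ^ 3) := mul_le_mul_of_nonneg_left h3 (Nat.cast_nonneg _)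
    _ = 64 * R ^ 3 * ((farDefSet P).card : ℝ) := by ring

/-- With S5 proved, **S2 follows from S1 ∧ S3 alone** (modulo vacancy planting). -/
theorem cleanNear_of_isolated_descent (hV : VacancyPlanting) (hD : FrozenDescent)
    (hI : IsolatedNearDefectsPay) : CleanNearCoercivity :=
  cleanNear_of_isolated_collar_descent hV hD hI collarCount

/-- And the glue's `NearCoercivityModCollar` needs only S3 now. -/
theorem modCollar_of_isolated (hI : IsolatedNearDefectsPay) : NearCoercivityModCollar := by
  obtain ⟨c, hc, R, hR, ε, hε, ρ, hρ, H⟩ := hI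
  obtain ⟨C, HK⟩ := collarCount
  refine ⟨c, hc, c * (max C 0 * R ^ 3), by positivity, ε, hε, ρ, hρ, fun P hP hpos => ?_⟩
  have h1 := H P hP hpos
  have h5 := isolFrac_ge (fun P => HK R hR P) (by linarith) P
  have := mul_le_mul_of_nonneg_left h5 hc.le
  linarith

end collar

end Drefute


end Summit.AtomisticToContinuum.Crystallization.Cruxes.PeriodicStarCoercivity.PinnedEquilibriaReduction

end
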